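import Summits.ResolutionOfSingularities.ResolutionOfSingularities.Theorems.FrobeniusClosingSteerBinaryResidueWindowKernelOdd
import HarnessLib

/-!
# hARᵒ H2 — kernel piece F1′: the adapted rational window kernel WITH SQUARES at ODD exponent `d = 2e + 1`
# (an `m`-ary residue MODULO SQUARES of the weak transform at the later member, read modulo the exceptional divisor, gives an `m`-ary
# residue of `F` modulo `x`·SQUARES at the earlier member; Theses-free, def-free; characteristic `2`)

OURS (campaign `res-hironaka`, rung L ★L-G4, slot W4.1 · crux `Steer` (stmt-ResolutionOfSingularities-16345) · hARᵒ H2 programme,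
P0 FILE 1 of res-L0-w41-plan-1's `P0-BRIEF-hARo.md` b66a17a38113b83f / RULING 214(b); design res-type-062 `H2-DESIGN.md` 7dac75913b6b98e3 §5;
seat res-D-lib-2 g10). COPY-LEVEL twin of res-type-028's `exists_sub_sq_mem_sup_of_window` (`…BinaryResidueWindowKernel`, `d = 2e`) and of
the square-free `mem_sup_of_window` (`…BinaryResidueWindowKernelOdd`, any `d`): the same proof with the square part carried at ODD `d`,
where `x^d · q(u')² = x · (x^e · q̃)²` is `x` times a square instead of a square. Not a statement of the manuscript under review
[claim: Hironaka2017, status: under-review]; AI-produced, weaker than expert review.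

THE SETTING (an ADAPTED RATIONAL point window `S ≤ S' ⊆ L`, `char L = 2`). `S` local with `𝔪_S = (x, u₁, …, u_n)`, `S'` regular local
of dimension `n + 1` with `𝔪_{S'} = (x, u'₁, …, u'_n)`, `u_j = x · u'_j`, RATIONAL (`∀ a ∈ S', ∃ b ∈ S, a - b ∈ 𝔪_{S'}`), the law
`f' · x^d = F` with `F ∈ 𝔪_S^d`, `d = 2e + 1`.

* §1 `eq_sq_add_bind₁_of_sub_sq_mem_odd` — piece 1 at odd `d`: `C(u) − g² ∈ (ℓ(u))^d + 𝔪_O^(d+1)`, `deg C ≤ d = 2e+1` ⇒ `C = q² + R(ℓ)`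
  with `deg q ≤ e` (`g ≡ q(u) (𝔪^(e+1))` ⇒ `g² ≡ q(u)² (𝔪^(2e+2) = 𝔪^(d+1))`; Taylor rigidity).
* §2 `exists_sub_mul_sq_mem_sup_of_map_residue_eq` — piece 2 at odd `d`: `C̄ = q² + R(ℓ)` ⇒ `F − x·G² ∈ (σ)^d + 𝔪_S^(d+1)` with
  `G = x^e q̃(u')` homogenised (`ι(x·G²) = ι(x)^(2e+1) q(u')²`).
* §3 **`exists_sub_mul_sq_mem_sup_of_window`** — THE KERNEL F1′: if `f' − g'² ∈ (σ'₁, …, σ'_m)^d + 𝔪_{S'}^(d+1) + (x)` with `σ'_k ∈ 𝔪_{S'}`,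
  then `F − x·G² ∈ (σ₁, …, σ_m)^d + 𝔪_S^(d+1)` for some `G ∈ S`, `σ_k = Σ_j a_kj u_j`, AND `σ'_k ≡ Σ_j a_kj u'_j (mod 𝔪_{S'}² + (x))`;
  `exists_sub_mul_sq_mem_pow_of_window` — its `m = 0` reading (`f' − g'² ∈ 𝔪_{S'}^(d+1) + (x)` ⇒ `F − x·G² ∈ 𝔪_S^(d+1)`), the shape
  Fβ `…BinaryResidueExceptionalTwice` consumes. USES (H2-DESIGN §5): F1′(m=0) then F1(m=0) in Fβ; F1′(m=2) in F4ʳᵘⁿ.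
[cite: Matsumura1987, Thm. 14.2, Thm. 17.10] [folklore]
-/

noncomputable section

-- `Summit.<S>.<S>.…` duplicates the summit name by design (single-problem summit).
set_option linter.dupNamespace false

open IsLocalRing MvPolynomial

namespace Summit.ResolutionOfSingularities.ResolutionOfSingularities.Theorems.SwitchingDichotomy.BinaryResidue

open Literature.AlgebraicGeometry.Resolution

universe u v

/-! ## §1 Piece 1 with squares at odd `d` -/

section rational

variable {κ : Type u} {O : Type v} [Field κ] [CommRing O] [Algebra κ O]

/-- **Piece 1, odd `d = 2e + 1`.** `O` regular local of characteristic `2`, rational over `κ`, regular parameters `u`; `C ∈ κ[T]` of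
total degree `≤ d` with `C(u) − g² ∈ (ℓ₁(u), …, ℓ_m(u))^d + 𝔪_O^(d+1)` for linear forms `ℓ_k` ⇒ `C = q² + R(ℓ₁, …, ℓ_m)` with
`deg q ≤ e` and `R` a `κ`-form of degree `d` (res-type-028's `eq_sq_add_bind₁_of_sub_sq_mem`, odd copy: `g ≡ q(u) (𝔪^(e+1))` gives
`g² ≡ q(u)² (𝔪^(d+1))`). [cite: Matsumura1987, Thm. 17.10] -/
theorem eq_sq_add_bind₁_of_sub_sq_mem_odd [IsRegularLocalRing O] (h2 : (2 : O) = 0) {n : ℕ}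
    (hn : (maximalIdeal O).spanFinrank = n) (u : Fin n → O) (hu : Ideal.span (Set.range u) = maximalIdeal O)
    (hrat : ∀ o : O, ∃ c : κ, o - algebraMap κ O c ∈ maximalIdeal O) {d e : ℕ} (hde : d = 2 * e + 1)
    (C : MvPolynomial (Fin n) κ) (hC : C.totalDegree ≤ d) (g : O) {m : ℕ}
    (ℓ : Fin m → MvPolynomial (Fin n) κ) (hℓ : ∀ i, (ℓ i).IsHomogeneous 1)
    (h : aeval u C - g ^ 2 ∈
      Ideal.span (Set.range fun i => aeval u (ℓ i)) ^ d ⊔ maximalIdeal O ^ (d + 1)) :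
    ∃ q : MvPolynomial (Fin n) κ, q.totalDegree ≤ e ∧ ∃ R : MvPolynomial (Fin m) κ, R.IsHomogeneous d ∧
      C = q ^ 2 + bind₁ ℓ R := by
  obtain ⟨y, hy, w, hw, hyw⟩ := Submodule.mem_sup.mp h
  obtain ⟨q, hq, hqg⟩ := exists_totalDegree_le_sub_aeval_mem_pow u hu hrat e g
  obtain ⟨R, hR, hRy⟩ := exists_isHomogeneous_sub_aeval_bind₁_mem_pow u hu hrat ℓ hℓ hy
  refine ⟨q, hq, R, hR, ?_⟩
  rw [← sub_eq_zero]
  refine eq_zero_of_totalDegree_le_of_aeval_mem_pow hn u hu (N := d) ?_ ?_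
  · refine (totalDegree_sub _ _).trans (max_le hC ((totalDegree_add _ _).trans (max_le ?_ ?_)))
    · refine (totalDegree_pow _ _).trans ?_
      have := Nat.mul_le_mul_left 2 hq
      omega
    · exact (isHomogeneous_bind₁ hℓ hR).totalDegree_le
  · have hsq : g ^ 2 - aeval u q ^ 2 ∈ maximalIdeal O ^ (d + 1) := by
      rw [sq_sub_sq_of_two_eq_zero h2]
      have := Ideal.pow_mem_pow hqg 2
      rw [← pow_mul] at this
      exact Ideal.pow_le_pow_right (by omega) this
    have hexp : aeval u (C - (q ^ 2 + bind₁ ℓ R)) =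
        (y - aeval u (bind₁ ℓ R)) + w + (g ^ 2 - aeval u q ^ 2) := by
      simp only [map_sub, map_add, map_pow]
      linear_combination (-1 : O) * hyw
    rw [hexp]
    exact add_mem (add_mem hRy hw) hsq

end rational

/-! ## §2 Piece 2 with squares at odd `d`: assembly at the earlier member -/

section assembly

variable {S : Type u} {T : Type v} [CommRing S] [IsLocalRing S] [CommRing T]

/-- **Piece 2, odd `d = 2e + 1`.** `ι : S → T` injective, `x, u_j ∈ 𝔪_S`, `ι(u_j) = ι(x)·u'_j`, `C ∈ S[T]` of degree `≤ d` with
`ι F = ι(x)^d · C(u')`; if the reduction of `C` is `q² + R(ℓ₁, …, ℓ_m)` with `deg q ≤ e`, `ℓ_k = Σ_j c_kj T_j`, `R` a `κ`-form of degree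
`d`, then for lifts `a_kj` of the `c_kj` and `G` = the `e`-homogenised evaluation of a lift of `q`: `F − x·G² ∈ (Σ_j a_1j u_j, …)^d + 𝔪_S^(d+1)`
(res-type-028's `exists_sub_sq_mem_sup_of_map_residue_eq`, odd copy: `ι(x)^d q(u')² = ι(x)·(ι(x)^e q(u'))²`). [folklore] -/
theorem exists_sub_mul_sq_mem_sup_of_map_residue_eq (ι : S →+* T) (hι : Function.Injective ι)
    {x : S} (hx : x ∈ maximalIdeal S) {n : ℕ} {u : Fin n → S} (hum : ∀ j, u j ∈ maximalIdeal S)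
    (u' : Fin n → T) (hu : ∀ j, ι (u j) = ι x * u' j) {d e : ℕ} (hde : d = 2 * e + 1)
    (C : MvPolynomial (Fin n) S) (hC : C.totalDegree ≤ d) (F : S) (hF : ι F = ι x ^ d * eval₂ ι u' C)
    (q : MvPolynomial (Fin n) (ResidueField S)) (hq : q.totalDegree ≤ e) {m : ℕ}
    (c : Fin m → Fin n → ResidueField S)
    (R : MvPolynomial (Fin m) (ResidueField S)) (hR : R.IsHomogeneous d)
    (hid : map (residue S) C = q ^ 2 + bind₁ (fun k => ∑ j, MvPolynomial.C (c k j) * X j) R) :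
    ∃ a : Fin m → Fin n → S, (∀ k j, residue S (a k j) = c k j) ∧
      ∃ G : S, F - x * G ^ 2 ∈ Ideal.span (Set.range fun k => ∑ j, a k j * u j) ^ d ⊔ maximalIdeal S ^ (d + 1) := by
  classical
  have hsurj : Function.Surjective (residue S) := residue_surjective
  obtain ⟨q', hq'q, hq'⟩ := exists_map_eq_totalDegree_le (residue S) hsurj q
  obtain ⟨R', hR'R, hR'⟩ := exists_map_eq_isHomogeneous (residue S) hsurj hR
  choose a ha using fun k j => hsurj (c k j)
  refine ⟨a, ha, ?_⟩
  set ℓ' : Fin m → MvPolynomial (Fin n) S := fun k => ∑ j, MvPolynomial.C (a k j) * X j with hℓ'def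
  have hℓ' : ∀ k, (ℓ' k).IsHomogeneous 1 := fun k => isHomogeneous_one_sum_C_mul_X (a k)
  have hℓ'ℓ : ∀ k, map (residue S) (ℓ' k) = ∑ j, MvPolynomial.C (c k j) * X j := fun k => by
    simp only [hℓ'def, map_sum, map_mul, map_C, map_X, ha]
  -- the error polynomial
  set D : MvPolynomial (Fin n) S := C - (q' ^ 2 + bind₁ ℓ' R') with hD
  have hD0 : ∀ β, D.coeff β ∈ maximalIdeal S := by
    intro β
    rw [← residue_eq_zero_iff, ← coeff_map]
    have : map (residue S) D = 0 := by
      rw [hD, map_sub, map_add, map_pow, hq'q, map_bind₁, hR'R, hid]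
      simp only [hℓ'ℓ]
      exact sub_eq_zero.mpr rfl
    rw [this, coeff_zero]
  have hDdeg : D.totalDegree ≤ d := by
    refine (totalDegree_sub _ _).trans (max_le hC ((totalDegree_add _ _).trans (max_le ?_ ?_)))
    · refine (totalDegree_pow _ _).trans ?_
      have := Nat.mul_le_mul_left 2 (hq'.trans hq)
      omega
    · have h := hR'.eval₂ (MvPolynomial.C : S →+* MvPolynomial (Fin n) S) ℓ' (fun r => isHomogeneous_C _ r) hℓ'
      rw [one_mul] at h
      have hb : (bind₁ ℓ' R').IsHomogeneous d := by
        simpa only [bind₁, aeval_def, algebraMap_eq, coe_eval₂Hom] using h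
      exact hb.totalDegree_le
  -- the witnesses
  set G : S := ∑ β ∈ q'.support, q'.coeff β * x ^ (e - β.degree) * β.prod fun j k => u j ^ k with hG
  set w : S := ∑ β ∈ D.support, D.coeff β * x ^ (d - β.degree) * β.prod fun j k => u j ^ k with hw
  set v : Fin m → S := fun k => eval u (ℓ' k) with hv
  have hvsum : (fun k => ∑ j, a k j * u j) = v := by
    funext k
    simp only [hv, hℓ'def, map_sum, map_mul, eval_C, eval_X]
  set y : S := eval v R' with hy
  have hwmem : w ∈ maximalIdeal S ^ (d + 1) := sum_homogenised_mem_pow _ hx hum D hDdeg hD0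
  have hymem : y ∈ Ideal.span (Set.range v) ^ d := eval_mem_span_range_pow v hR'
  rw [hvsum]
  refine ⟨G, Submodule.mem_sup.mpr ⟨y, hymem, w, hwmem, ?_⟩⟩
  -- the identity `y + w = F - x·G²`, checked under the injection `ι`
  apply hι
  have hGι : ι G = ι x ^ e * eval₂ ι u' q' := map_sum_homogenised_eq ι x u u' hu q' (hq'.trans hq)
  have hwι : ι w = ι x ^ d * eval₂ ι u' D := map_sum_homogenised_eq ι x u u' hu D hDdeg
  have hvι : ∀ i, ι (v i) = ι x * eval₂ ι u' (ℓ' i) := by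
    intro i
    show ι (eval u (ℓ' i)) = _
    rw [show eval u (ℓ' i) = eval₂ (RingHom.id S) u (ℓ' i) from rfl, eval₂_comp_left, RingHom.comp_id,
      show (⇑ι ∘ u) = ι x • u' from funext fun j => by simp [hu], eval₂_smul_eq ι (hℓ' i), pow_one]
  have hyι : ι y = ι x ^ d * eval₂ ι u' (bind₁ ℓ' R') := by
    rw [hy, show eval v R' = eval₂ (RingHom.id S) v R' from rfl, eval₂_comp_left, RingHom.comp_id,
      show (⇑ι ∘ v) = ι x • fun i => eval₂ ι u' (ℓ' i) from funext fun i => by simp [hvι],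
      eval₂_smul_eq ι hR', show eval₂ ι u' (bind₁ ℓ' R') = eval₂Hom ι u' (bind₁ ℓ' R') from rfl, eval₂Hom_bind₁]
    rfl
  have hCι : eval₂ ι u' C = eval₂ ι u' q' ^ 2 + eval₂ ι u' (bind₁ ℓ' R') + eval₂ ι u' D := by
    rw [hD]; simp only [eval₂_sub, eval₂_add, eval₂_pow]; ring
  rw [map_add, map_sub, map_mul, map_pow, hyι, hwι, hF, hGι, hCι, hde]
  ring

end assembly

/-! ## §3 The kernel F1′ -/

section kernel

variable {L : Type} [Field L]

/-- **The adapted rational window kernel with squares at odd `d = 2e + 1` (F1′).** See the module docstring: from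
`f' − g'² ∈ (σ')^d + 𝔪_{S'}^(d+1) + (x)` at the later member to `F − x·G² ∈ (σ)^d + 𝔪_S^(d+1)` at the earlier member,
`σ_k = Σ_j a_kj u_j`, with the linear parts `σ'_k ≡ Σ_j a_kj u'_j (mod 𝔪_{S'}² + (x))`. [cite: Matsumura1987, Thm. 14.2, Thm. 17.10] [folklore] -/
theorem exists_sub_mul_sq_mem_sup_of_window (h2 : (2 : L) = 0) (S S' : Subring L) [IsLocalRing S] [IsLocalRing S']
    (hle : S ≤ S') (hreg' : IsRegularLocalRing S') {n : ℕ} (hdim' : ringKrullDim S' = (n + 1 : ℕ))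
    (x : S) (hx0 : (x : L) ≠ 0) (u : Fin n → S) (hxu : Ideal.span (insert x (Set.range u)) = maximalIdeal S)
    (u' : Fin n → S') (hu : ∀ j, ((u j : S) : L) = (x : L) * ((u' j : S') : L))
    (hm' : Ideal.span (insert (⟨(x : L), hle x.2⟩ : S') (Set.range u')) = maximalIdeal S')
    (hrat : ∀ a : S', ∃ b : S, a - ⟨(b : L), hle b.2⟩ ∈ maximalIdeal S')
    {d e : ℕ} (hde : d = 2 * e + 1) (F : S) (f' : S')
    (hlaw : ((f' : S') : L) * (x : L) ^ d = ((F : S) : L))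
    (hFd : F ∈ maximalIdeal S ^ d)
    {m : ℕ} (σ' : Fin m → S') (hσ' : ∀ k, σ' k ∈ maximalIdeal S') (g' : S')
    (h : f' - g' ^ 2 ∈ Ideal.span (Set.range σ') ^ d ⊔ maximalIdeal S' ^ (d + 1) ⊔
      Ideal.span {(⟨(x : L), hle x.2⟩ : S')}) :
    ∃ (a : Fin m → Fin n → S) (G : S),
      (∀ k, σ' k - ∑ j, (⟨((a k j : S) : L), hle (a k j).2⟩ : S') * u' j ∈
        maximalIdeal S' ^ 2 ⊔ Ideal.span {(⟨(x : L), hle x.2⟩ : S')}) ∧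
      F - x * G ^ 2 ∈ Ideal.span (Set.range fun k => ∑ j, a k j * u j) ^ d ⊔ maximalIdeal S ^ (d + 1) := by
  classical
  set x' : S' := ⟨(x : L), hle x.2⟩ with hx'def
  set I : Ideal S' := Ideal.span (Set.range ![x']) with hIdef
  have hx'I : x' ∈ I := Ideal.subset_span ⟨0, rfl⟩
  have hIx : I = Ideal.span {x'} := by
    rw [hIdef]; congr 1; ext a; simp
  -- §2: the quotient `O`
  obtain ⟨hO, hn, hū⟩ := quotient_span_singleton_rsop hreg' x' u' hm' hdim'
  set O := S' ⧸ I
  set mk : S' →+* O := Ideal.Quotient.mk I with hmkdef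
  set ū : Fin n → O := mk ∘ u' with hūdef
  haveI : IsRegularLocalRing O := hO
  -- `κ = S/𝔪_S` maps to `O` (`𝔪_S ⊆ (x) S'`)
  set incl : S →+* S' := Subring.inclusion hle with hincl
  have hxm : x ∈ maximalIdeal S := hxu ▸ Ideal.subset_span (Set.mem_insert _ _)
  have hum : ∀ j, u j ∈ maximalIdeal S := fun j => hxu ▸ Ideal.subset_span (Set.mem_insert_of_mem _ ⟨j, rfl⟩)
  have hincl_u : ∀ j, incl (u j) = x' * u' j := fun j =>
    Subtype.ext (by rw [hincl, Subring.coe_inclusion]; exact hu j)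
  have hker : ∀ a ∈ maximalIdeal S, (mk.comp incl) a = 0 := by
    intro a ha
    rw [← hxu] at ha
    rw [RingHom.comp_apply, hmkdef, Ideal.Quotient.eq_zero_iff_mem]
    refine Submodule.span_induction ?_ (by simp) (fun a b _ _ ha hb => ?_) (fun r a _ ha => ?_) ha
    · rintro a (rfl | ⟨j, rfl⟩)
      · exact hx'I
      · rw [hincl_u j]
        exact I.mul_mem_right _ hx'I
    · rw [map_add]; exact add_mem ha hb
    · rw [smul_eq_mul, map_mul]; exact I.mul_mem_left _ ha
  set ι₀ : ResidueField S →+* O := Ideal.Quotient.lift (maximalIdeal S) (mk.comp incl) hker with hι₀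
  letI : Algebra (ResidueField S) O := ι₀.toAlgebra
  have hι₀res : ∀ b : S, algebraMap (ResidueField S) O (residue S b) = mk (incl b) := fun b => by
    show ι₀ (residue S b) = _
    rw [hι₀]; rfl
  have hratO : ∀ o : O, ∃ c : ResidueField S, o - algebraMap (ResidueField S) O c ∈ maximalIdeal O := by
    intro o
    obtain ⟨a, rfl⟩ := Ideal.Quotient.mk_surjective (I := I) o
    obtain ⟨b, hb⟩ := hrat a
    refine ⟨residue S b, ?_⟩
    rw [hι₀res, ← map_maximalIdeal_of_surjective mk Ideal.Quotient.mk_surjective]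
    change mk a - mk (incl b) ∈ _
    rw [← map_sub]
    exact Ideal.mem_map_of_mem _ hb
  have h2S' : (2 : S') = 0 := by
    apply Subtype.ext
    change S'.subtype 2 = S'.subtype 0
    rw [map_ofNat, map_zero]; exact h2
  have h2O : (2 : O) = 0 := by rw [← map_ofNat mk 2, h2S', map_zero]
  -- §3a: the hypothesis in `O`
  set σbar : Fin m → O := mk ∘ σ' with hσbar
  have hO1 : mk f' - mk g' ^ 2 ∈ Ideal.span (Set.range σbar) ^ d ⊔ maximalIdeal O ^ (d + 1) := by
    have := Ideal.mem_map_of_mem mk h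
    rw [Ideal.map_sup, Ideal.map_sup, Ideal.map_pow, Ideal.map_pow, Ideal.map_span, ← Set.range_comp,
      map_maximalIdeal_of_surjective mk Ideal.Quotient.mk_surjective, Ideal.map_span, Set.image_singleton,
      (Ideal.Quotient.eq_zero_iff_mem.mpr hx'I : mk x' = 0), Ideal.span_singleton_zero, sup_bot_eq,
      map_sub, map_pow] at this
    exact this
  -- §3b: linear parts of the `σ̄'_k`
  have hlin : ∀ k, ∃ c : Fin n → ResidueField S,
      σbar k - aeval ū (∑ j, MvPolynomial.C (c j) * X j) ∈ maximalIdeal O ^ 2 := by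
    intro k
    have hk : σbar k ∈ Ideal.span (Set.range ū) := by
      rw [hū, ← map_maximalIdeal_of_surjective mk Ideal.Quotient.mk_surjective]
      exact Ideal.mem_map_of_mem _ (hσ' k)
    obtain ⟨o, ho⟩ := (Ideal.mem_span_range_iff_exists_fun (R := O)).mp hk
    choose c hc using fun j => hratO (o j)
    refine ⟨c, ?_⟩
    have : σbar k - aeval ū (∑ j, MvPolynomial.C (c j) * X j) =
        ∑ j, (o j - algebraMap (ResidueField S) O (c j)) * ū j := by
      simp only [map_sum, map_mul, algHom_C, aeval_X, ← ho, sub_mul, Finset.sum_sub_distrib]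
    rw [this, pow_two]
    exact Ideal.sum_mem _ fun j _ => Ideal.mul_mem_mul (hc j) (hū ▸ Ideal.subset_span ⟨j, rfl⟩)
  choose c hc using hlin
  set ℓ : Fin m → MvPolynomial (Fin n) (ResidueField S) := fun k => ∑ j, MvPolynomial.C (c k j) * X j with hℓ
  have hℓ1 : ∀ k, (ℓ k).IsHomogeneous 1 := fun k => isHomogeneous_one_sum_C_mul_X (c k)
  have hvm : Ideal.span (Set.range fun k => aeval ū (ℓ k)) ≤ maximalIdeal O := by
    rw [Ideal.span_le]
    rintro _ ⟨k, rfl⟩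
    have := eval_mem_span_pow ū ((hℓ1 k).map (algebraMap (ResidueField S) O))
    rw [eval_map, ← aeval_def, pow_one, hū] at this
    exact this
  have hO2 : mk f' - mk g' ^ 2 ∈ Ideal.span (Set.range fun k => aeval ū (ℓ k)) ^ d ⊔ maximalIdeal O ^ (d + 1) := by
    have hle' : Ideal.span (Set.range σbar) ≤ Ideal.span (Set.range fun k => aeval ū (ℓ k)) ⊔ maximalIdeal O ^ 2 := by
      rw [Ideal.span_le]
      rintro _ ⟨k, rfl⟩
      have : σbar k = aeval ū (ℓ k) + (σbar k - aeval ū (ℓ k)) := by ring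
      rw [SetLike.mem_coe, this]
      exact add_mem (Ideal.mem_sup_left (Ideal.subset_span ⟨k, rfl⟩)) (Ideal.mem_sup_right (hc k))
    have hpow := pow_le_pow_sup_pow_succ hle' hvm d
    obtain ⟨y, hy, w, hw, hyw⟩ := Submodule.mem_sup.mp hO1
    rw [← hyw]
    obtain ⟨y₁, hy₁, y₂, hy₂, rfl⟩ := Submodule.mem_sup.mp (hpow hy)
    rw [add_assoc]
    exact add_mem (Ideal.mem_sup_left hy₁) (Ideal.mem_sup_right (add_mem hy₂ hw))
  -- §3c: the dehomogenised degree-`d` Taylor polynomial `C` with `f' = C(u')`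
  set xu : Fin (n + 1) → S := Fin.cons x u with hxudef
  have hFd' : F ∈ Ideal.span (Set.range xu) ^ d := by
    rwa [hxudef, Fin.range_cons, hxu]
  obtain ⟨Φ, hΦ, hΦev⟩ := exists_isHomogeneous_of_mem_span_pow xu d hFd'
  set C : MvPolynomial (Fin n) S := bind₁ (Fin.cons 1 X : Fin (n + 1) → MvPolynomial (Fin n) S) Φ with hCdef
  have hC : C.totalDegree ≤ d := by
    refine (totalDegree_bind₁_le_of_le_one (fun i => ?_) Φ).trans hΦ.totalDegree_le
    refine Fin.cases ?_ (fun j => ?_) i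
    · simp
    · simp [totalDegree_X]
  set uL : Fin n → L := fun j => ((u' j : S') : L) with huL
  have hcons : (⇑S.subtype ∘ xu) = (x : L) • (Fin.cons 1 uL : Fin (n + 1) → L) := by
    funext i
    refine Fin.cases ?_ (fun j => ?_) i
    · simp [hxudef]
    · simp [hxudef, huL, hu j]
  have hfun : (fun i => eval₂Hom S.subtype uL ((Fin.cons 1 X : Fin (n + 1) → MvPolynomial (Fin n) S) i)) =
      (Fin.cons 1 uL : Fin (n + 1) → L) := by
    funext i
    refine Fin.cases ?_ (fun j => ?_) i
    · simp
    · simp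
  have hevC : eval₂ S.subtype uL C = eval₂ S.subtype (Fin.cons 1 uL : Fin (n + 1) → L) Φ := by
    rw [hCdef]
    change eval₂Hom S.subtype uL (bind₁ (Fin.cons 1 X) Φ) = eval₂Hom S.subtype (Fin.cons 1 uL) Φ
    rw [eval₂Hom_bind₁, hfun]
  have hF : S.subtype F = S.subtype x ^ d * eval₂ S.subtype uL C := by
    rw [← hΦev, show eval xu Φ = eval₂ (RingHom.id S) xu Φ from rfl,
      eval₂_comp_left, RingHom.comp_id, hcons, eval₂_smul_eq S.subtype hΦ, hevC]
    rfl
  have hf'L : ((f' : S') : L) = eval₂ S.subtype uL C := by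
    have h1 : ((f' : S') : L) * (x : L) ^ d = (x : L) ^ d * eval₂ S.subtype uL C := by
      rw [hlaw]; exact hF
    have hxd : (x : L) ^ d ≠ 0 := pow_ne_zero _ hx0
    calc ((f' : S') : L) = ((f' : S') : L) * (x : L) ^ d / (x : L) ^ d := by field_simp
      _ = eval₂ S.subtype uL C := by rw [h1]; field_simp
  have hf'S' : f' = eval₂ incl u' C := by
    apply Subtype.ext
    rw [hf'L, show ((eval₂ incl u' C : S') : L) = S'.subtype (eval₂ incl u' C) from rfl, eval₂_comp_left]
    rfl
  have hmkf' : mk f' = aeval ū (map (residue S) C) := by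
    rw [hf'S', eval₂_comp_left, aeval_def, eval₂_map]
    congr 1
  -- §3d″: piece 1 with squares, odd `d`, in `O`
  have hCbar : (map (residue S) C).totalDegree ≤ d :=
    le_trans (Finset.sup_mono (support_map_subset _ _)) hC
  obtain ⟨q, hq, R, hR, hid⟩ := eq_sq_add_bind₁_of_sub_sq_mem_odd h2O hn ū hū hratO hde (map (residue S) C) hCbar
    (mk g') ℓ hℓ1 (hmkf' ▸ hO2)
  -- §3e″: piece 2 with squares, odd `d`, at `S`
  obtain ⟨a, ha, G, hmem⟩ := exists_sub_mul_sq_mem_sup_of_map_residue_eq S.subtype Subtype.coe_injective hxm hum uL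
    (fun j => hu j) hde C hC F hF q hq c R hR hid
  refine ⟨a, G, fun k => ?_, hmem⟩
  -- the linear parts: `σ'_k − Σ_j a_kj u'_j ∈ 𝔪_{S'}² + (x)`
  have hak : ∀ j, mk (⟨((a k j : S) : L), hle (a k j).2⟩ : S') = algebraMap (ResidueField S) O (c k j) := fun j => by
    rw [← ha k j, hι₀res]; rfl
  have hdiff : mk (σ' k - ∑ j, (⟨((a k j : S) : L), hle (a k j).2⟩ : S') * u' j) =
      σbar k - aeval ū (ℓ k) := by
    simp only [map_sub, map_sum, map_mul, hak, hℓ, algHom_C, aeval_X, hσbar, hūdef, Function.comp_apply]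
  have hmem2 : mk (σ' k - ∑ j, (⟨((a k j : S) : L), hle (a k j).2⟩ : S') * u' j) ∈
      Ideal.map mk (maximalIdeal S' ^ 2) := by
    rw [hdiff, Ideal.map_pow, map_maximalIdeal_of_surjective mk Ideal.Quotient.mk_surjective]
    exact hc k
  rw [Ideal.mem_map_iff_of_surjective mk Ideal.Quotient.mk_surjective] at hmem2
  obtain ⟨z, hz, hzeq⟩ := hmem2
  rw [hmkdef, Ideal.Quotient.eq] at hzeq
  rw [← hIx]
  have : σ' k - ∑ j, (⟨((a k j : S) : L), hle (a k j).2⟩ : S') * u' j =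
      z - (z - (σ' k - ∑ j, (⟨((a k j : S) : L), hle (a k j).2⟩ : S') * u' j)) := by ring
  rw [this]
  exact sub_mem (Ideal.mem_sup_left hz) (Ideal.mem_sup_right hzeq)

/-- **F1′ with no letters (`m = 0`).** If `f' − g'² ∈ 𝔪_{S'}^(d+1) + (x)` at the later member of an adapted rational window with odd
`d = 2e + 1`, then `F − x·G² ∈ 𝔪_S^(d+1)` for some `G ∈ S` (the reading Fβ `…BinaryResidueExceptionalTwice` uses). [folklore] -/
theorem exists_sub_mul_sq_mem_pow_of_window (h2 : (2 : L) = 0) (S S' : Subring L) [IsLocalRing S] [IsLocalRing S']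
    (hle : S ≤ S') (hreg' : IsRegularLocalRing S') {n : ℕ} (hdim' : ringKrullDim S' = (n + 1 : ℕ))
    (x : S) (hx0 : (x : L) ≠ 0) (u : Fin n → S) (hxu : Ideal.span (insert x (Set.range u)) = maximalIdeal S)
    (u' : Fin n → S') (hu : ∀ j, ((u j : S) : L) = (x : L) * ((u' j : S') : L))
    (hm' : Ideal.span (insert (⟨(x : L), hle x.2⟩ : S') (Set.range u')) = maximalIdeal S')
    (hrat : ∀ a : S', ∃ b : S, a - ⟨(b : L), hle b.2⟩ ∈ maximalIdeal S')
    {d e : ℕ} (hde : d = 2 * e + 1) (F : S) (f' : S')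
    (hlaw : ((f' : S') : L) * (x : L) ^ d = ((F : S) : L))
    (hFd : F ∈ maximalIdeal S ^ d) (g' : S')
    (h : f' - g' ^ 2 ∈ maximalIdeal S' ^ (d + 1) ⊔ Ideal.span {(⟨(x : L), hle x.2⟩ : S')}) :
    ∃ G : S, F - x * G ^ 2 ∈ maximalIdeal S ^ (d + 1) := by
  have hd : d ≠ 0 := by omega
  set σ' : Fin 0 → S' := Fin.elim0 with hσ'def
  have h' : f' - g' ^ 2 ∈ Ideal.span (Set.range σ') ^ d ⊔ maximalIdeal S' ^ (d + 1) ⊔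
      Ideal.span {(⟨(x : L), hle x.2⟩ : S')} := by
    rw [sup_assoc]
    exact Ideal.mem_sup_right h
  obtain ⟨a, G, -, hG⟩ := exists_sub_mul_sq_mem_sup_of_window h2 S S' hle hreg' hdim' x hx0 u hxu u' hu hm' hrat hde F f'
    hlaw hFd σ' (fun k => k.elim0) g' h'
  refine ⟨G, ?_⟩
  have h0 : Ideal.span (Set.range fun k : Fin 0 => ∑ j, a k j * u j) ^ d ≤ maximalIdeal S ^ (d + 1) := by
    rw [Set.range_eq_empty, Ideal.span_empty, ← Ideal.zero_eq_bot, zero_pow hd]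
    exact bot_le
  exact sup_le h0 le_rfl hG

end kernel

end Summit.ResolutionOfSingularities.ResolutionOfSingularities.Theorems.SwitchingDichotomy.BinaryResidue

end
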